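import Mathlib.Analysis.SpecialFunctions.Complex.Circle
import Mathlib.Analysis.Calculus.ContDiff.Operations
import Mathlib.Data.Sign.Defs
import HarnessLib

/-!
# Coordinates on the Cartan subgroups of `H_∞ = U(1,1)^W × U(1)^W` and `G′_∞ = U(σ_w diag α)(ℂ)^W`: regular sets, Shelstad's normaliser `R_T`,
# the half-sum twist, the wall normal and the Cayley point — GROUP-FREE (Shelstad 1979 §4; Bouaziz 1994 §3.1, §6.2; Rogawski 1990 §8.2)

Topic `NumberTheory/Automorphic`; namespace `Literature.NumberTheory.Automorphic.ArchCartan`.  Definitions WITH BODIES and theorems only (no instance, no notation,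
no axiom, no named fact, no `sorry`).  Cell `pub/hodgecm-mathlib`, line LH3 (closer stub `stub_N9`, crux H413 = `stmt-HodgeConjecture-24833`); organ **(COORD)** of the
LH3 direct road (LH3-plan (g2) DEALER WORDS #7, D2-SPEC v1 §1 ∕ D2′-SPEC v1 §1, 2026-09-02): the COORDINATE-LEVEL objects that the Cartan atlas (T-ATLAS, LH3-p03), the
Bouaziz predicate `ArchBouazizSpaceH` (D2) and the Harish-Chandra predicate `ArchHCSpaceG` (D2′) share.  No group appears in this file: everything is a function on the
common coordinate space `c : W → Fin 3 → ℝ` over a FINITE index type `W` (the consumers take `W := {w : InfinitePlace L // IsComplex w}`, the index of ★ `archPiEquivCM`),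
with `DecidableEq W` a binder (never `Classical` inside a definition).  Author LH3-p01 (g3).

CONVENTIONS (one coordinate space for every Cartan class; classes ↔ `S : Finset W` = the SPLIT places).
* Compact place `w ∉ S`: `c w 0 = θ₀`, `c w 2 = θ₂` are the angles of the 2-block (eigenvalues `e^{iθ₀}, e^{iθ₂}`; on `G′` also `c w 1 = θ₁`), `c w 1` the angle of the
  `U(Φ₁)`-block.  Angles are read through `Circle.exp` (the currency of ★ `archDiagTorus` ∕ ★ (3H) ∕ ★ `ArchEndoscopicDeltaSideContinuous`).
* Split place `w ∈ S` (SAME on `H` and on `G′`): `c w 0 = x` (half the log-modulus gap: hyperbolic pair `e^{±x + iθ}`), `c w 1` = the angle of the compact line (on `H`: the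
  `U(Φ₁)`-block), `c w 2 = θ` the phase of the pair.  Hence `RegG S ⊆ RegS S`, and `RegG S` is the `G`-regular locus of the `H`-torus of type `S`.
* Wall normal WITHOUT the `½`: `nrm w = δ_{w,0} − δ_{w,2}`, so that `c + ν • nrm w` has 2-block angles `θ̄ ± ν` — `ν` IS the `ψ` of (C-bdry) ★ `ArchTorusOrbitalOneSidedLimits`
  (half the angle gap) and the Cayley partner of `x` (half the log-modulus gap).
* Normalisers = Shelstad's `R_T` [Shelstad1979, §4 p. 22] (= Bouaziz's `b_Ψ |D|^{1∕2}` [Bouaziz1994IntegralesOrbitales, §3.1 p. 579]): imaginary roots SIGNED with the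
  positive system `i < j` (factor `1 − ξ_{−α} = 1 − e^{i(θ_j − θ_i)}`), real and complex roots by absolute value.

WHAT IS HERE.  §1 regular sets `RegS ∕ InRegS ∕ RegG ∕ InRegG` (+ `2πk` readings, openness, inclusions); §2 the coordinate moves `angleShift`, `flipAt`, `negXAt`, `nrm`,
`cayPt` (+ apply lemmas, periodicity of the angle readings).  Their smoothness, the normalisers `R_T` (`archRH ∕ archRG`) and the half-sum twists (`archERho ∕ archERhoG`) over these
coordinates are the sibling file `ArchCartanNormalisers`.
HONEST LABEL: HC_CM is proved only modulo the 7 printed citations (2 remaining: hLiu418 = stmt-HodgeConjecture-24832, h413 = stmt-HodgeConjecture-24833) until rung 0 closes;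
this file is coordinate bookkeeping and pays nothing by itself.

## References
* [Shelstad1979] D. Shelstad, *Characters and inner forms of a quasi-split group over ℝ*, Compositio Math. 39 (1979), §4 pp. 22–26 (`R_T`, `T^I_reg`, the Cayley transform
  data, jumps of `Ψ^T_f`).
* [Bouaziz1994IntegralesOrbitales] A. Bouaziz, *Intégrales orbitales sur les groupes de Lie réductifs*, Ann. Sci. ÉNS 27 (1994) 573–609, §3.1 p. 579 (`b_Ψ`, `I(U)`),
  §6.2 p. 591 (`T^st_in-reg`, the factor `r_Ψ`).
* [Rogawski1990] J. D. Rogawski, *Automorphic Representations of Unitary Groups in Three Variables*, Ann. of Math. Stud. 123 (1990), §8.2 pp. 118–124 (the curve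
  `(θ+ψ, θ₁, θ−ψ)` and the normaliser `2 sin ψ`), §14.3 p. 234 (`H_∞`).
-/

set_option autoImplicit false

noncomputable section

open Complex Set Function Real

namespace Literature.NumberTheory.Automorphic.ArchCartan

variable {W : Type*}

/-! ## §1 Regular sets -/

section RegularSets

/-- **`RegS S` — the regular set of the `H`-Cartan of type `S`** (split at `w ∈ S`, compact at `w ∉ S`): the two 2-block eigenvalues differ — `e^{iθ₀} ≠ e^{iθ₂}` at a compact
place, `x ≠ 0` at a split place.  (`H`-regular; the `G`-regular locus is `RegG S`.) [cite: Shelstad1979, §4 p. 22] [cite: Bouaziz1994IntegralesOrbitales, §3.1 p. 579] -/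
def RegS (S : Finset W) : Set (W → Fin 3 → ℝ) :=
  {c | (∀ w, w ∉ S → Circle.exp (c w 0) ≠ Circle.exp (c w 2)) ∧ ∀ w, w ∈ S → c w 0 ≠ 0}

/-- **`InRegS S` — Bouaziz's `T_{in-reg}`** for the `H`-Cartan of type `S`: only the IMAGINARY (noncompact) walls `e^{iθ₀} = e^{iθ₂}` at the compact places are removed; the
real walls `x = 0` at the split places are allowed (there are no compact roots in `H_∞`, so `T^st_{in-reg} = T_{in-reg}`). [cite: Bouaziz1994IntegralesOrbitales, §6.2 p. 591] -/
def InRegS (S : Finset W) : Set (W → Fin 3 → ℝ) :=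
  {c | ∀ w, w ∉ S → Circle.exp (c w 0) ≠ Circle.exp (c w 2)}

/-- **`RegG S′` — the regular set of the `G′`-Cartan of type `S′`** (noncompact at `w ∈ S′`): the three eigenvalues `e^{iθ_i}` are pairwise distinct at a compact place, `x ≠ 0`
at a split place (then `e^{±x+iθ} ≠ e^{iφ}` is automatic).  With the common split-chart convention it is also the `G`-regular locus of the `H`-torus of type `S′`.
[cite: Shelstad1979, §4 p. 22] [cite: Rogawski1990, §8.2 p. 118] -/
def RegG (S' : Finset W) : Set (W → Fin 3 → ℝ) :=
  {c | (∀ w, w ∉ S' → Function.Injective fun i : Fin 3 => Circle.exp (c w i)) ∧ ∀ w, w ∈ S' → c w 0 ≠ 0}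

/-- **`InRegG s S′` — `T_{in-reg}` on the `G′` side**: for the sign pattern `s w i = sgn re σ_w(α_i)` of the diagonal form, only the NONCOMPACT imaginary walls (`e^{iθ_i} = e^{iθ_j}`
with `s w i ≠ s w j`) at the compact places are removed; compact walls (`s w i = s w j`) and the real walls at split places are allowed.
[cite: Bouaziz1994IntegralesOrbitales, §6.2 p. 591] [cite: Shelstad1979, §4 p. 23] -/
def InRegG (s : W → Fin 3 → SignType) (S' : Finset W) : Set (W → Fin 3 → ℝ) :=
  {c | ∀ w, w ∉ S' → ∀ i j : Fin 3, i ≠ j → s w i ≠ s w j → Circle.exp (c w i) ≠ Circle.exp (c w j)}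

/-- Unfolding of `RegS`. [cite: Shelstad1979, §4 p. 22] -/
theorem mem_regS_iff (S : Finset W) (c : W → Fin 3 → ℝ) :
    c ∈ RegS S ↔ (∀ w, w ∉ S → Circle.exp (c w 0) ≠ Circle.exp (c w 2)) ∧ ∀ w, w ∈ S → c w 0 ≠ 0 :=
  Iff.rfl

/-- Unfolding of `InRegS`. [cite: Bouaziz1994IntegralesOrbitales, §6.2 p. 591] -/
theorem mem_inRegS_iff (S : Finset W) (c : W → Fin 3 → ℝ) : c ∈ InRegS S ↔ ∀ w, w ∉ S → Circle.exp (c w 0) ≠ Circle.exp (c w 2) :=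
  Iff.rfl

/-- Unfolding of `RegG`. [cite: Shelstad1979, §4 p. 22] -/
theorem mem_regG_iff (S' : Finset W) (c : W → Fin 3 → ℝ) :
    c ∈ RegG S' ↔ (∀ w, w ∉ S' → Function.Injective fun i : Fin 3 => Circle.exp (c w i)) ∧ ∀ w, w ∈ S' → c w 0 ≠ 0 :=
  Iff.rfl

/-- Unfolding of `InRegG`. [cite: Bouaziz1994IntegralesOrbitales, §6.2 p. 591] -/
theorem mem_inRegG_iff (s : W → Fin 3 → SignType) (S' : Finset W) (c : W → Fin 3 → ℝ) :
    c ∈ InRegG s S' ↔ ∀ w, w ∉ S' → ∀ i j : Fin 3, i ≠ j → s w i ≠ s w j → Circle.exp (c w i) ≠ Circle.exp (c w j) :=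
  Iff.rfl

/-- The `2πk` reading of an angular wall: `e^{ia} ≠ e^{ib}` iff `a − b ∉ 2πℤ` (Mathlib `Circle.exp_eq_exp`). [cite: Rogawski1990, §8.2 p. 118] -/
theorem circleExp_ne_iff_forall_int (a b : ℝ) : Circle.exp a ≠ Circle.exp b ↔ ∀ k : ℤ, a - b ≠ 2 * π * k := by
  rw [Ne, Circle.exp_eq_exp, not_exists]
  refine forall_congr' fun k => ?_
  constructor
  · intro h hk
    exact h (by linarith)
  · intro h hk
    exact h (by linarith)

/-- `RegS` in the `2πk` spelling of D2-SPEC §1. [cite: Shelstad1979, §4 p. 22] -/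
theorem mem_regS_iff_forall_int (S : Finset W) (c : W → Fin 3 → ℝ) :
    c ∈ RegS S ↔ (∀ w, w ∉ S → ∀ k : ℤ, c w 0 - c w 2 ≠ 2 * π * k) ∧ ∀ w, w ∈ S → c w 0 ≠ 0 := by
  simp only [mem_regS_iff, circleExp_ne_iff_forall_int]

/-- `InRegS` in the `2πk` spelling. [cite: Bouaziz1994IntegralesOrbitales, §6.2 p. 591] -/
theorem mem_inRegS_iff_forall_int (S : Finset W) (c : W → Fin 3 → ℝ) :
    c ∈ InRegS S ↔ ∀ w, w ∉ S → ∀ k : ℤ, c w 0 - c w 2 ≠ 2 * π * k := by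
  simp only [mem_inRegS_iff, circleExp_ne_iff_forall_int]

/-- `RegS S ⊆ InRegS S`. [cite: Bouaziz1994IntegralesOrbitales, §6.2 p. 591] -/
theorem regS_subset_inRegS (S : Finset W) : RegS S ⊆ InRegS S := fun _ hc => hc.1

/-- `RegG S ⊆ RegS S` (the `G`-regular locus of the `H`-torus of type `S` lies in its `H`-regular locus: `0 ≠ 2` in `Fin 3`). [cite: Rogawski1990, §4.3 p. 42] -/
theorem regG_subset_regS (S : Finset W) : RegG S ⊆ RegS S := by
  intro c hc
  refine ⟨fun w hw h => ?_, hc.2⟩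
  have h02 : (0 : Fin 3) = 2 := hc.1 w hw h
  exact absurd h02 (by decide)

/-- `RegG S′ ⊆ InRegG s S′` for every sign pattern. [cite: Bouaziz1994IntegralesOrbitales, §6.2 p. 591] -/
theorem regG_subset_inRegG (s : W → Fin 3 → SignType) (S' : Finset W) : RegG S' ⊆ InRegG s S' :=
  fun _ hc w hw _ _ hij _ h => hij (hc.1 w hw h)

/-- The coordinate-angle map `c ↦ e^{i c w i}` is continuous. [cite: Rogawski1990, §8.2 p. 118] -/
theorem continuous_circleExp_coord (w : W) (i : Fin 3) : Continuous fun c : W → Fin 3 → ℝ => Circle.exp (c w i) :=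
  Circle.exp.continuous.comp ((continuous_apply i).comp (continuous_apply w))

/-- `InRegS` ignores the split places, so it grows with `S`. [cite: Bouaziz1994IntegralesOrbitales, §6.2 p. 591] -/
theorem inRegS_mono {S S' : Finset W} (h : S ⊆ S') : InRegS S ⊆ InRegS S' :=
  fun _ hc w hw => hc w fun hwS => hw (h hwS)

/-- The injective coordinate triples form an open set (finite intersection of `≠`-conditions in the Hausdorff `Circle`). [cite: Rogawski1990, §8.2 p. 118] -/
theorem isOpen_setOf_injective_circleExp (w : W) : IsOpen {c : W → Fin 3 → ℝ | Function.Injective fun i : Fin 3 => Circle.exp (c w i)} := by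
  have h : {c : W → Fin 3 → ℝ | Function.Injective fun i : Fin 3 => Circle.exp (c w i)} =
      ⋂ p ∈ {p : Fin 3 × Fin 3 | p.1 ≠ p.2}, {c : W → Fin 3 → ℝ | Circle.exp (c w p.1) ≠ Circle.exp (c w p.2)} := by
    ext c
    simp only [mem_setOf_eq, mem_iInter, Prod.forall]
    constructor
    · intro hc i j hij h
      exact hij (hc h)
    · intro hc i j h
      by_contra hij
      exact hc i j hij h
  rw [h]
  exact (Set.toFinite _).isOpen_biInter fun p _ => isOpen_ne_fun (continuous_circleExp_coord w p.1) (continuous_circleExp_coord w p.2)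

end RegularSets

section Open

variable [Finite W]

/-- `InRegS S` is open. [cite: Bouaziz1994IntegralesOrbitales, §3.1 p. 579] -/
theorem isOpen_inRegS (S : Finset W) : IsOpen (InRegS S) := by
  have h : InRegS S = ⋂ w ∈ ((↑S : Set W)ᶜ), {c : W → Fin 3 → ℝ | Circle.exp (c w 0) ≠ Circle.exp (c w 2)} := by
    ext c
    simp only [InRegS, mem_setOf_eq, mem_iInter, mem_compl_iff, Finset.mem_coe]
  rw [h]
  exact (Set.toFinite _).isOpen_biInter fun w _ => isOpen_ne_fun (continuous_circleExp_coord w 0) (continuous_circleExp_coord w 2)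

/-- `RegS S` is open. [cite: Bouaziz1994IntegralesOrbitales, §3.1 p. 579] -/
theorem isOpen_regS (S : Finset W) : IsOpen (RegS S) := by
  have h : RegS S = InRegS S ∩ ⋂ w ∈ (↑S : Set W), {c : W → Fin 3 → ℝ | c w 0 ≠ 0} := by
    ext c
    simp only [RegS, InRegS, mem_setOf_eq, mem_inter_iff, mem_iInter, Finset.mem_coe]
  rw [h]
  exact (isOpen_inRegS S).inter
    ((Set.toFinite _).isOpen_biInter fun w _ => isOpen_ne_fun ((continuous_apply 0).comp (continuous_apply w)) continuous_const)

/-- `RegG S′` is open. [cite: Bouaziz1994IntegralesOrbitales, §3.1 p. 579] -/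
theorem isOpen_regG (S' : Finset W) : IsOpen (RegG S') := by
  have h : RegG S' = (⋂ w ∈ ((↑S' : Set W)ᶜ), {c : W → Fin 3 → ℝ | Function.Injective fun i : Fin 3 => Circle.exp (c w i)}) ∩
      ⋂ w ∈ (↑S' : Set W), {c : W → Fin 3 → ℝ | c w 0 ≠ 0} := by
    ext c
    simp only [RegG, mem_setOf_eq, mem_inter_iff, mem_iInter, mem_compl_iff, Finset.mem_coe]
  rw [h]
  exact ((Set.toFinite _).isOpen_biInter fun w _ => isOpen_setOf_injective_circleExp w).inter
    ((Set.toFinite _).isOpen_biInter fun w _ => isOpen_ne_fun ((continuous_apply 0).comp (continuous_apply w)) continuous_const)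

/-- `InRegG s S′` is open. [cite: Bouaziz1994IntegralesOrbitales, §6.2 p. 591] -/
theorem isOpen_inRegG (s : W → Fin 3 → SignType) (S' : Finset W) : IsOpen (InRegG s S') := by
  have h : InRegG s S' = ⋂ w ∈ ((↑S' : Set W)ᶜ), ⋂ p ∈ {p : Fin 3 × Fin 3 | p.1 ≠ p.2 ∧ s w p.1 ≠ s w p.2},
      {c : W → Fin 3 → ℝ | Circle.exp (c w p.1) ≠ Circle.exp (c w p.2)} := by
    ext c
    simp only [InRegG, mem_setOf_eq, mem_iInter, mem_compl_iff, Finset.mem_coe, Prod.forall, and_imp]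
  rw [h]
  exact (Set.toFinite _).isOpen_biInter fun w _ => (Set.toFinite _).isOpen_biInter fun p _ =>
    isOpen_ne_fun (continuous_circleExp_coord w p.1) (continuous_circleExp_coord w p.2)

end Open

/-! ## §2 Coordinate moves: periodic shifts, the flip, the sign change, the wall normal, the Cayley point -/

section Moves

variable [DecidableEq W]

/-- The shift of the `(w, i)`-coordinate by `2πk`. [cite: Shelstad1979, §4 p. 22] -/
def angleShift (w : W) (i : Fin 3) (k : ℤ) : W → Fin 3 → ℝ :=
  Pi.single w (Pi.single i (2 * π * k))

/-- The flip at `w`: `θ₀ ↔ θ₂` (the stable, non-realised Weyl reflection of the compact 2-block; ★ `injective_conjClassesMk_flip`). [cite: Shelstad1979, §4 p. 23] -/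
def flipAt (w : W) (c : W → Fin 3 → ℝ) : W → Fin 3 → ℝ :=
  Function.update c w ![c w 2, c w 1, c w 0]

/-- The sign change at `w`: `c w 0 ↦ −c w 0` (at a split place: the realised real reflection `x ↦ −x`). [cite: Shelstad1979, §4 p. 23] -/
def negXAt (w : W) (c : W → Fin 3 → ℝ) : W → Fin 3 → ℝ :=
  Function.update c w ![-c w 0, c w 1, c w 2]

/-- The wall normal at `w`: `nrm w = δ_{w,0} − δ_{w,2}` (NO factor `½`: `c + ν • nrm w` has 2-block angles `θ₀ + ν`, `θ₂ − ν`, so `ν` is the `ψ` of the curve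
`(θ+ψ, θ₁, θ−ψ)` of print and of (C-bdry)). [cite: Rogawski1990, §8.2 p. 122] [cite: Shelstad1979, §4 p. 25] -/
def nrm (w : W) : W → Fin 3 → ℝ :=
  Pi.single w ![(1 : ℝ), 0, -1]

/-- The Cayley point of `c` at `w`: the same torus point read in the chart where `w` is SPLIT — `x_w := 0`, phase `θ_w := (θ₀ + θ₂)∕2`, the compact-line angle `c w 1` and all
other places unchanged (on the wall `θ₀ − θ₂ ∈ 2πℤ` this is the point `γ₀ = γ₀^s` of the standard Cayley transform). [cite: Shelstad1979, §4 p. 25] -/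
def cayPt (w : W) (c : W → Fin 3 → ℝ) : W → Fin 3 → ℝ :=
  Function.update c w ![0, c w 1, (c w 0 + c w 2) / 2]

/-- `angleShift` at the shifted coordinate. [cite: Shelstad1979, §4 p. 22] -/
@[simp] theorem angleShift_apply_self (w : W) (i : Fin 3) (k : ℤ) : angleShift w i k w i = 2 * π * k := by
  rw [angleShift, Pi.single_eq_same, Pi.single_eq_same]

/-- `angleShift` vanishes at the other places. [cite: Shelstad1979, §4 p. 22] -/
theorem angleShift_apply_of_ne {w w' : W} (h : w' ≠ w) (i : Fin 3) (k : ℤ) : angleShift w i k w' = 0 := by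
  rw [angleShift, Pi.single_eq_of_ne h]

/-- `angleShift` vanishes at the other coordinates of the same place. [cite: Shelstad1979, §4 p. 22] -/
theorem angleShift_apply_self_of_ne (w : W) {i j : Fin 3} (h : j ≠ i) (k : ℤ) : angleShift w i k w j = 0 := by
  rw [angleShift, Pi.single_eq_same, Pi.single_eq_of_ne h]

/-- **Angles are `2π`-periodic**: every `e^{i c w′ j}` is unchanged by `angleShift w i k`. [cite: Shelstad1979, §4 p. 22] -/
theorem circleExp_add_angleShift (c : W → Fin 3 → ℝ) (w : W) (i : Fin 3) (k : ℤ) (w' : W) (j : Fin 3) :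
    Circle.exp ((c + angleShift w i k) w' j) = Circle.exp (c w' j) := by
  rw [Pi.add_apply, Pi.add_apply]
  by_cases hw : w' = w
  · subst hw
    by_cases hj : j = i
    · subst hj
      rw [angleShift_apply_self, Circle.exp_add, Circle.exp_two_pi_mul_int, mul_one]
    · rw [angleShift_apply_self_of_ne w' hj, add_zero]
  · rw [angleShift_apply_of_ne hw, Pi.zero_apply, add_zero]

/-- `InRegS` is invariant under every `angleShift` (it reads angles only). [cite: Bouaziz1994IntegralesOrbitales, §6.2 p. 591] -/
theorem add_angleShift_mem_inRegS_iff (S : Finset W) (c : W → Fin 3 → ℝ) (w : W) (i : Fin 3) (k : ℤ) :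
    c + angleShift w i k ∈ InRegS S ↔ c ∈ InRegS S := by
  simp only [mem_inRegS_iff, circleExp_add_angleShift]

/-- `RegS` is invariant under the ANGULAR shifts (`w ∉ S` or `i ≠ 0`: the split coordinate `x = c w 0`, `w ∈ S`, is not periodic). [cite: Shelstad1979, §4 p. 22] -/
theorem add_angleShift_mem_regS_iff (S : Finset W) (c : W → Fin 3 → ℝ) {w : W} {i : Fin 3} (h : w ∉ S ∨ i ≠ 0) (k : ℤ) :
    c + angleShift w i k ∈ RegS S ↔ c ∈ RegS S := by
  simp only [mem_regS_iff, circleExp_add_angleShift]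
  refine and_congr_right fun _ => forall_congr' fun w' => forall_congr' fun hw' => ?_
  have h0 : (c + angleShift w i k) w' 0 = c w' 0 := by
    rw [Pi.add_apply, Pi.add_apply]
    by_cases hw : w' = w
    · subst hw
      rcases h with h | h
      · exact absurd hw' h
      · rw [angleShift_apply_self_of_ne w' h.symm, add_zero]
    · rw [angleShift_apply_of_ne hw, Pi.zero_apply, add_zero]
  rw [h0]

/-- `flipAt` at the flipped place. [cite: Shelstad1979, §4 p. 23] -/
@[simp] theorem flipAt_apply_self (w : W) (c : W → Fin 3 → ℝ) : flipAt w c w = ![c w 2, c w 1, c w 0] := by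
  rw [flipAt, Function.update_self]

/-- `flipAt` at the other places. [cite: Shelstad1979, §4 p. 23] -/
theorem flipAt_apply_of_ne {w w' : W} (h : w' ≠ w) (c : W → Fin 3 → ℝ) : flipAt w c w' = c w' := by
  rw [flipAt, Function.update_of_ne h]

/-- `flipAt w` is an involution. [cite: Shelstad1979, §4 p. 23] -/
theorem flipAt_flipAt (w : W) (c : W → Fin 3 → ℝ) : flipAt w (flipAt w c) = c := by
  funext w' j
  by_cases hw : w' = w
  · subst hw
    rw [flipAt_apply_self]
    fin_cases j
    · simp [flipAt_apply_self]
    · simp [flipAt_apply_self]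
    · simp [flipAt_apply_self]
  · rw [flipAt_apply_of_ne hw, flipAt_apply_of_ne hw]

/-- `negXAt` at the changed place. [cite: Shelstad1979, §4 p. 23] -/
@[simp] theorem negXAt_apply_self (w : W) (c : W → Fin 3 → ℝ) : negXAt w c w = ![-c w 0, c w 1, c w 2] := by
  rw [negXAt, Function.update_self]

/-- `negXAt` at the other places. [cite: Shelstad1979, §4 p. 23] -/
theorem negXAt_apply_of_ne {w w' : W} (h : w' ≠ w) (c : W → Fin 3 → ℝ) : negXAt w c w' = c w' := by
  rw [negXAt, Function.update_of_ne h]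

/-- `negXAt w` is an involution. [cite: Shelstad1979, §4 p. 23] -/
theorem negXAt_negXAt (w : W) (c : W → Fin 3 → ℝ) : negXAt w (negXAt w c) = c := by
  funext w' j
  by_cases hw : w' = w
  · subst hw
    rw [negXAt_apply_self]
    fin_cases j
    · simp [negXAt_apply_self]
    · simp [negXAt_apply_self]
    · simp [negXAt_apply_self]
  · rw [negXAt_apply_of_ne hw, negXAt_apply_of_ne hw]

/-- `RegS` is flip-invariant at a compact place. [cite: Shelstad1979, §4 p. 23] -/
theorem flipAt_mem_regS_iff (S : Finset W) {w : W} (hw : w ∉ S) (c : W → Fin 3 → ℝ) : flipAt w c ∈ RegS S ↔ c ∈ RegS S := by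
  simp only [mem_regS_iff]
  refine and_congr (forall_congr' fun w' => forall_congr' fun hw' => ?_) (forall_congr' fun w' => forall_congr' fun hw' => ?_)
  · by_cases h : w' = w
    · subst h
      simp only [flipAt_apply_self, Matrix.cons_val_zero, Matrix.cons_val_two, Matrix.tail_cons, Matrix.head_cons]
      exact ne_comm
    · rw [flipAt_apply_of_ne h]
  · have h : w' ≠ w := fun h => hw (h ▸ hw')
    rw [flipAt_apply_of_ne h]

/-- `RegS` is invariant under `x ↦ −x` at a split place. [cite: Shelstad1979, §4 p. 23] -/
theorem negXAt_mem_regS_iff (S : Finset W) {w : W} (hw : w ∈ S) (c : W → Fin 3 → ℝ) : negXAt w c ∈ RegS S ↔ c ∈ RegS S := by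
  simp only [mem_regS_iff]
  refine and_congr (forall_congr' fun w' => forall_congr' fun hw' => ?_) (forall_congr' fun w' => forall_congr' fun hw' => ?_)
  · have h : w' ≠ w := fun h => hw' (h ▸ hw)
    rw [negXAt_apply_of_ne h]
  · by_cases h : w' = w
    · subst h
      simp only [negXAt_apply_self, Matrix.cons_val_zero, ne_eq, neg_eq_zero]
    · rw [negXAt_apply_of_ne h]

/-- The normal curve moves the two 2-block angles apart symmetrically: `(c + ν • nrm w) w = (θ₀ + ν, θ₁, θ₂ − ν)`. [cite: Rogawski1990, §8.2 p. 122] -/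
theorem add_smul_nrm_apply_self (c : W → Fin 3 → ℝ) (ν : ℝ) (w : W) :
    (c + ν • nrm w) w = ![c w 0 + ν, c w 1, c w 2 - ν] := by
  funext j
  simp only [nrm, Pi.add_apply, Pi.smul_apply, Pi.single_eq_same, smul_eq_mul]
  fin_cases j
  · simp
  · simp
  · simp [sub_eq_add_neg]

/-- The normal curve does not move the other places. [cite: Rogawski1990, §8.2 p. 122] -/
theorem add_smul_nrm_apply_of_ne (c : W → Fin 3 → ℝ) (ν : ℝ) {w w' : W} (h : w' ≠ w) : (c + ν • nrm w) w' = c w' := by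
  funext j
  rw [Pi.add_apply, Pi.smul_apply, nrm, Pi.single_eq_of_ne h, smul_zero, add_zero]

/-- Along the normal curve the angle gap is `θ₀ − θ₂ + 2ν` (so `ν` is HALF the gap measured from the base point). [cite: Rogawski1990, §8.2 p. 122] -/
theorem add_smul_nrm_gap (c : W → Fin 3 → ℝ) (ν : ℝ) (w : W) :
    (c + ν • nrm w) w 0 - (c + ν • nrm w) w 2 = c w 0 - c w 2 + 2 * ν := by
  rw [add_smul_nrm_apply_self]
  simp only [Matrix.cons_val_zero, Matrix.cons_val_two, Matrix.tail_cons, Matrix.head_cons]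
  ring

/-- `cayPt` at the Cayley place: `x = 0`, the compact-line angle, the mean phase. [cite: Shelstad1979, §4 p. 25] -/
@[simp] theorem cayPt_apply_self (w : W) (c : W → Fin 3 → ℝ) : cayPt w c w = ![0, c w 1, (c w 0 + c w 2) / 2] := by
  rw [cayPt, Function.update_self]

/-- `cayPt` at the other places. [cite: Shelstad1979, §4 p. 25] -/
theorem cayPt_apply_of_ne {w w' : W} (h : w' ≠ w) (c : W → Fin 3 → ℝ) : cayPt w c w' = c w' := by
  rw [cayPt, Function.update_of_ne h]

/-- The Cayley point lies on the REAL wall `x_w = 0` of the split chart at `w`. [cite: Shelstad1979, §4 p. 25] -/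
theorem cayPt_apply_self_zero (w : W) (c : W → Fin 3 → ℝ) : cayPt w c w 0 = 0 := by
  rw [cayPt_apply_self, Matrix.cons_val_zero]

/-- The Cayley point at `w` is in `InRegS (insert w S)` iff `c` is (the place `w` is split there, hence not read). [cite: Shelstad1979, §4 p. 25] -/
theorem cayPt_mem_inRegS_insert_iff (S : Finset W) (w : W) (c : W → Fin 3 → ℝ) :
    cayPt w c ∈ InRegS (insert w S) ↔ c ∈ InRegS (insert w S) := by
  simp only [mem_inRegS_iff, Finset.mem_insert, not_or]
  refine forall_congr' fun w' => forall_congr' fun hw' => ?_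
  rw [cayPt_apply_of_ne hw'.1]

/-- A point of `InRegS S` read at its Cayley place: `cayPt w c ∈ InRegS (insert w S)` (semiregular wall points land in `T_{in-reg}` of the split chart).
[cite: Shelstad1979, §4 p. 25] [cite: Bouaziz1994IntegralesOrbitales, §6.2 p. 591] -/
theorem cayPt_mem_inRegS_insert {S : Finset W} {c : W → Fin 3 → ℝ} (hc : c ∈ InRegS S) (w : W) : cayPt w c ∈ InRegS (insert w S) :=
  (cayPt_mem_inRegS_insert_iff S w c).2 (inRegS_mono (Finset.subset_insert w S) hc)

end Moves



end Literature.NumberTheory.Automorphic.ArchCartan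

end
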